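import Summits.QuantumFields.BalabanUV.T4Continuum.Support.NE7DipoleWitnessField
import HarnessLib

/-!
# NE7 (pub-balaban, rung (B)+1, d = 4, SU(2), L = 2): THE PURE-GAUGE DIPOLE WITNESS, II — all averages and frames of `1^{u}` are trivial; the linearised objects of `X` vanish

Cell `pub-balaban`, rung (B)+1 sub-cell t4, lineage `b2b-balaban-t4-ne7-p1` (CRUX PROVER NE7 #1 = OWNER of row NE7), generation 98; memo `t4/b2b-balaban-t4-ne7-p1-g98/ROAD-G98.md` §3.2.

WHY.  Second file of the dipole witness (see `NE7DipoleWitnessField`): at the block corners `2z` every constituent holonomy of `1^{u}` starts and ends on `2ℤ⁴` where `u = 1`,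
and the block sums of `λ` vanish, so `bavg = 1`, `Favg = 0`, `vframe = 1`, `dbavg = 1` — hence **`dbavgCovIter 2 1 (1^{u}) 1 = 1`** (`hdbar`) and **`vcov 2 1 (1^{u}) 1 ≡ 1`**
(`v₁ ≡ 1`) EXACTLY; and `framePotW 2 1 1 X = 0`, `cpush 2 1 X = 0` (K1 + corner vanishing), `curl 1 X = 0`, `‖X‖_w² ≤ #F·4·(2t‖Λ₀‖)²`; the spikes and the tangent datum of `X`
vanish; and the CORE CONTRADICTION `m1_line_false`: `Σ_F‖−λ‖ ≥ t‖Λ₀‖` against `m₁·8·‖X‖_w² ≤ 8|m₁|·C_F·t²`.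

HONEST FRAMING (page 1): an explicit finite witness over landed kernel definitions; nothing of Bałaban's asserted or refuted; NE7 NOT PROVED; spine 0∕9; finite T⁴ rung (B)+1 — NOT
infinite volume, NOT mass gap, NOT `BetaPertH`, NOT Clay.  Continuum YM on T⁴ ⇐ BetaPertH ∧ nine spine estimates (0/9 proved).

WHAT ([folklore]; 0 def, 0 sorry).
-/

namespace Summit.QuantumFields.BalabanUV.T4Continuum.NE7DipoleWitnessFrames

open scoped BigOperators Matrix Matrix.Norms.L2Operator Topology
open NormedSpace Finset

open Literature.MathematicalPhysics.QuantumFieldTheory.Balaban1983to89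
open B7Prop1Explicit B7Prop2Explicit B7Prop3Flat MatrixLog UnitaryModel MatrixNorms
open T4AveragingDeficitWall (Ad IsUnitaryCfg IsSkewDir SmallField vary curl curlAt curlSq dirSq)
open T4AveragingDeficitWallBoundary (IsPeriodicCfg periodBox mem_periodBox)
open AveragingDeficitPeriodicCounting (IsPeriodicDir)
open AveragingDeficitMultiLevelPrep (LevelSmall tower TangentIter cpush)
open AveragingDeficitTransport (mem_U1_of_unitary nReTr_eq_zero_of_mem_skewAdjoint curl_mem_skewAdjoint)
open AveragingDeficitNearIdentity (Ad_one)
open MinimalActionLevels (perWin)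
open MinimalActionSandwich (admissible)
open MinimalActionRate (sfClass)
open NE3HessForm (dAction)
open NE3TangentCovariantTower (dirIter framePotW dirIter_one framePotW_one)
open NE3TangentCovariantStructure (Fbar cpush_gaugeDir)
open B7Eq92Concrete (vcov dbavgCovIter dbavgCovIter_succ dbavgCovIter_zero dbavgCov_one_left vcov_succ vcov_zero wframe_one_left)
open NE3.PairLandauB8Avg (relPert)
open BlockAveragePushDirGauge (gaugeDir isPeriodicDir_gaugeDir)
open NE3CornerSpikes (spikeW)
open NE3QbarIterCovLiftPrep (cruxC)
open NE3SmoothRightInverseW (rightInvW)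
open NE3RightInverseSolveLetters (thetaLoc)
open NE3RightInverseLetters (theta_lt_one_of_loc)
open NE3RightInverseSupLetters (norm_rightInvW_le)
open NE3EnergyShapes (IsUnitarySite IsPeriodicSite)
open NE3EnergyWeightedShapes (energyNormW)
open NE3FrameFreeSliceW (frameFreeBlockLandauW)
open NE3FrameFreeDecompositionLinear (zero_mem_frameFreeBlockLandauW)
open NE3GaugeDirFrames (frameLin_gaugeDir)
open NE3CurlOfGaugeDir (curlAt_gaugeDir)
open NE7ConstantFluxBackground (expUnit_add_smul expUnit_real_smul_mem_unitary)
open NE7HdecompOfTopNormalised (levelSmall_d4_L2 radius_identities)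
open B7BlockAvgLog (mlog_exp)
open B8Ineq130 (hol_one Wcx_one bavg_one)

noncomputable section

variable {n : Type} [Fintype n] [DecidableEq n]

open NE7DipoleWitnessField

section Witness

/-! ## §1 The averages and frames of `1^{u}` are trivial: `hdbar` and `v₁ ≡ 1` -/

/-- The one-step average of `1^{u}` at the corners is `1`. [folklore] -/
theorem bavg_corner [Nonempty n] {P : ℕ} (hP : 2 ∣ P) (t : ℝ) (z : Site 4) (κ : Fin 4) : bavg 2 (gaugeAct (uD (n := n) P t) 1) ((2 : ℤ) • z) κ = 1 := by
  rw [bavg_gaugeAct 2 (fun x => mem_U1_of_unitary (uD_unitary P t x)) _ _ _ (fun r => by rw [Wcx_one]; simp), bavg_one, mul_one,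
    uD_corner hP, one_mul]
  have : (2 : ℤ) • z + ((2 : ℕ) : ℤ) • e κ = (2 : ℤ) • (z + e κ) := by push_cast; rw [smul_add]
  rw [this, uD_corner hP, inv_one]

/-- The frame exponent of `1^{u}` at the corners vanishes (block sums of `λ` vanish). [folklore] -/
theorem Favg_corner {P : ℕ} (hP : 2 ∣ P) {t : ℝ} (ht : 0 ≤ t) (htl : t * ‖(Lam0 : Matrix n n ℂ)‖ < Real.log 2) (z : Site 4) :
    Favg 2 (gaugeAct (uD (n := n) P t) 1) ((2 : ℤ) • z) = 0 := by
  unfold Favg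
  have hterm : ∀ r : Fin 4 → Fin 2, mlog ((hol (gaugeAct (uD (n := n) P t) 1) ((2 : ℤ) • z) (treeWord (boxVec 2 r)) : (Matrix n n ℂ)ˣ) : Matrix n n ℂ)
      = -lamD P t ((2 : ℤ) • z + boxVec 2 r) := by
    intro r
    rw [hol_gaugeAct, hol_one, disp_treeWord, mul_one, uD_corner hP, one_mul]
    simp only [uD, val_inv_expUnit, val_expUnit]
    exact mlog_exp (by rw [norm_neg]; exact (norm_lamD_le P ht _).trans_lt htl)
  simp_rw [hterm]
  rw [← Finset.smul_sum, Finset.sum_neg_distrib, sum_lamD_block hP, neg_zero, smul_zero]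

/-- The block frame of `1^{u}` at the corners is `1`. [folklore] -/
theorem vframe_corner {P : ℕ} (hP : 2 ∣ P) {t : ℝ} (ht : 0 ≤ t) (htl : t * ‖(Lam0 : Matrix n n ℂ)‖ < Real.log 2) (z : Site 4) :
    vframe 2 (gaugeAct (uD (n := n) P t) 1) ((2 : ℤ) • z) = 1 := by
  unfold vframe; rw [Favg_corner hP ht htl]; exact T4AveragingDeficitWall.expUnit_zero

/-- The flat double-bar average of `1^{u}` at the corners is `1`. [folklore] -/
theorem dbavg_corner [Nonempty n] {P : ℕ} (hP : 2 ∣ P) {t : ℝ} (ht : 0 ≤ t) (htl : t * ‖(Lam0 : Matrix n n ℂ)‖ < Real.log 2) (z : Site 4) (κ : Fin 4) :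
    dbavg 2 (gaugeAct (uD (n := n) P t) 1) ((2 : ℤ) • z) κ = 1 := by
  unfold dbavg
  have : (2 : ℤ) • z + ((2 : ℕ) : ℤ) • e κ = (2 : ℤ) • (z + e κ) := by push_cast; rw [smul_add]
  rw [vframe_corner hP ht htl, bavg_corner hP, this, vframe_corner hP ht htl, inv_one, one_mul, one_mul]

/-- **`hdbar` FOR THE DIPOLE**: `dbavgCovIter 2 1 (1^{u}) 1 = 1`. [folklore] -/
theorem dbavgCovIter_one [Nonempty n] {P : ℕ} (hP : 2 ∣ P) {t : ℝ} (ht : 0 ≤ t) (htl : t * ‖(Lam0 : Matrix n n ℂ)‖ < Real.log 2) :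
    dbavgCovIter 2 (1 : Site 4 → Fin 4 → (Matrix n n ℂ)ˣ) (gaugeAct (uD (n := n) P t) 1) 1 = 1 := by
  funext z κ
  rw [dbavgCovIter_succ, avgIter_zero, dbavgCovIter_zero, dbavgCov_one_left, Pi.one_apply, Pi.one_apply]
  have : ((2 : ℕ) : ℤ) • z = (2 : ℤ) • z := by push_cast; rfl
  rw [this]
  exact dbavg_corner hP ht htl z κ

/-- **`v₁ ≡ 1` FOR THE DIPOLE**: `vcov 2 1 (1^{u}) 1 z = 1`. [folklore] -/
theorem vcov_one {P : ℕ} (hP : 2 ∣ P) {t : ℝ} (ht : 0 ≤ t) (htl : t * ‖(Lam0 : Matrix n n ℂ)‖ < Real.log 2) (z : Site 4) :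
    vcov 2 (1 : Site 4 → Fin 4 → (Matrix n n ℂ)ˣ) (gaugeAct (uD (n := n) P t) 1) 1 z = 1 := by
  rw [vcov_succ, vcov_zero, avgIter_zero, dbavgCovIter_zero, wframe_one_left, one_mul]
  have : ((2 : ℕ) : ℤ) • z = (2 : ℤ) • z := by push_cast; rfl
  rw [this]
  exact vframe_corner hP ht htl z

/-! ## §2 The linearised objects of the dipole field vanish; its energy is `O(t²)` -/

/-- The accumulated frame generator of `X` vanishes: `framePotW 2 1 1 X = 0`. [folklore] -/
theorem framePotW_XD {P : ℕ} (hP : 2 ∣ P) (t : ℝ) (z : Site 4) : framePotW 2 1 (1 : Site 4 → Fin 4 → (Matrix n n ℂ)ˣ) (XD (n := n) P t) z = 0 := by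
  rw [framePotW_one]
  unfold Fbar
  rw [XD, frameLin_gaugeDir (by norm_num)]
  have : ((2 : ℕ) : ℤ) • z = (2 : ℤ) • z := by push_cast; rfl
  rw [this, lamD_corner hP, zero_sub, neg_eq_zero]
  simp_rw [hol_one, Ad_one]
  rw [← Finset.smul_sum, sum_lamD_block hP, smul_zero]

/-- The linearised average of `X` vanishes: `cpush 2 1 X = 0` (period `P = 2M`). [folklore] -/
theorem cpush_XD [Nonempty n] {P : ℕ} (M : ℕ) [NeZero M] (hPM : P = 2 * M) (t : ℝ) :
    cpush 2 (1 : Site 4 → Fin 4 → (Matrix n n ℂ)ˣ) (XD (n := n) P t) = fun _ _ => 0 := by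
  have hWu : IsUnitaryCfg (1 : Site 4 → Fin 4 → (Matrix n n ℂ)ˣ) := fun _ _ => Subgroup.one_mem _
  have hWP : IsPeriodicCfg (1 : Site 4 → Fin 4 → (Matrix n n ℂ)ˣ) ((2 * M : ℕ) : ℤ) := fun _ _ _ => rfl
  have hWa : SmallField (1 : Site 4 → Fin 4 → (Matrix n n ℂ)ˣ) 0 := fun x κ κ' _ => by rw [hol_one]; simp
  have hlamP : ∀ (y : Site 4) (i : Fin 4), (lamD P t (y + ((2 * M : ℕ) : ℤ) • e i) : Matrix n n ℂ) = lamD P t y := by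
    intro y i; rw [← hPM]; exact lamD_periodic P t y i
  have h := cpush_gaugeDir (L := 2) (M := M) (by norm_num) hWu hWP le_rfl (by norm_num) hWa (lamD_mem (n := n) P t) hlamP
  rw [XD, h]
  have hl : (fun y : Site 4 => (lamD P t (((2 : ℕ) : ℤ) • y) : Matrix n n ℂ)) = fun _ => 0 := by
    funext y
    have : ((2 : ℕ) : ℤ) • y = (2 : ℤ) • y := by push_cast; rfl
    rw [this]; exact lamD_corner ⟨M, hPM⟩ t y
  rw [hl]
  funext y ν; simp [gaugeDir]

/-- The dressed curl of `X` at the flat background vanishes. [folklore] -/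
theorem curl_XD (P : ℕ) (t : ℝ) (p : T4AveragingDeficitWall.Plaq 4) : curl (1 : Site 4 → Fin 4 → (Matrix n n ℂ)ˣ) (XD (n := n) P t) p = 0 := by
  simp only [curl, XD]
  rw [curlAt_gaugeDir, hol_one, Ad_one, sub_self]

/-- The weighted energy of `X` is `O(t²)`: `‖X‖_w² ≤ #F·4·(2t‖Λ₀‖)²`. [folklore] -/
theorem energyNormW_XD_sq_le (P k : ℕ) {t : ℝ} (ht : 0 ≤ t) (F : Finset (Site 4)) :
    energyNormW 2 k (1 : Site 4 → Fin 4 → (Matrix n n ℂ)ˣ) (XD (n := n) P t) F ^ 2 ≤ (F.card : ℝ) * 4 * (2 * (t * ‖(Lam0 : Matrix n n ℂ)‖)) ^ 2 := by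
  set c : ℝ := 2 * (t * ‖(Lam0 : Matrix n n ℂ)‖) with hc_def
  have hc : curlSq (1 : Site 4 → Fin 4 → (Matrix n n ℂ)ˣ) (XD (n := n) P t) F = 0 := by
    unfold curlSq
    refine Finset.sum_eq_zero fun z _ => Finset.sum_eq_zero fun π _ => ?_
    rw [curl_XD, norm_zero]; norm_num
  have hterm : ∀ x ∈ F, ∑ κ : Fin 4, ‖XD (n := n) P t x κ‖ ^ 2 ≤ 4 * c ^ 2 := by
    intro x _
    calc ∑ κ : Fin 4, ‖XD (n := n) P t x κ‖ ^ 2 ≤ ∑ _κ : Fin 4, c ^ 2 :=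
          Finset.sum_le_sum fun κ _ => pow_le_pow_left₀ (norm_nonneg _) (norm_XD_le P ht x κ) 2
      _ = 4 * c ^ 2 := by rw [Finset.sum_const, Finset.card_univ, Fintype.card_fin, nsmul_eq_mul]; norm_num
  have hd : dirSq (XD (n := n) P t) F ≤ (F.card : ℝ) * 4 * c ^ 2 := by
    unfold dirSq
    calc ∑ x ∈ F, ∑ κ : Fin 4, ‖XD (n := n) P t x κ‖ ^ 2 ≤ ∑ _x ∈ F, 4 * c ^ 2 := Finset.sum_le_sum hterm
      _ = (F.card : ℝ) * 4 * c ^ 2 := by rw [Finset.sum_const, nsmul_eq_mul]; ring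
  have hd0 : 0 ≤ dirSq (XD (n := n) P t) F := by
    unfold dirSq; exact Finset.sum_nonneg fun x _ => Finset.sum_nonneg fun κ _ => sq_nonneg _
  have hw : ((((2 : ℕ) : ℝ) ^ k)⁻¹) ^ 2 ≤ 1 := by
    have h1 : (1 : ℝ) ≤ ((2 : ℕ) : ℝ) ^ k := one_le_pow₀ (by norm_num)
    have h2 : (((2 : ℕ) : ℝ) ^ k)⁻¹ ≤ 1 := inv_le_one_of_one_le₀ h1
    have h3 : 0 ≤ (((2 : ℕ) : ℝ) ^ k)⁻¹ := by positivity
    nlinarith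
  have hrad : 0 ≤ curlSq (1 : Site 4 → Fin 4 → (Matrix n n ℂ)ˣ) (XD (n := n) P t) F + ((((2 : ℕ) : ℝ) ^ k)⁻¹) ^ 2 * dirSq (XD (n := n) P t) F := by
    rw [hc, zero_add]; exact mul_nonneg (sq_nonneg _) hd0
  unfold energyNormW
  rw [Real.sq_sqrt hrad, hc, zero_add]
  calc ((((2 : ℕ) : ℝ) ^ k)⁻¹) ^ 2 * dirSq (XD (n := n) P t) F ≤ 1 * dirSq (XD (n := n) P t) F := mul_le_mul_of_nonneg_right hw hd0
    _ ≤ (F.card : ℝ) * 4 * c ^ 2 := by rw [one_mul]; exact hd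

/-! ## §3 The spikes and the tangent datum vanish; the core contradiction -/

/-- The spikes of `X` vanish: `gaugeDir 1 (spikeW 2 (framePotW 2 1 1 X)) = 0`. [folklore] -/
theorem spikes_XD {P : ℕ} (hP : 2 ∣ P) (t : ℝ) :
    gaugeDir (1 : Site 4 → Fin 4 → (Matrix n n ℂ)ˣ) (spikeW (2 ^ (0 + 1)) (framePotW 2 (0 + 1) 1 (XD (n := n) P t))) = fun _ _ => 0 := by
  have h0 : framePotW 2 (0 + 1) (1 : Site 4 → Fin 4 → (Matrix n n ℂ)ˣ) (XD (n := n) P t) = fun _ => 0 := funext fun z => framePotW_XD hP t z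
  rw [h0]
  funext y ν
  simp [gaugeDir, spikeW]

/-- The tangent datum of `X − spikes` vanishes: `dirIter 2 1 1 (X − S) = 0`. [folklore] -/
theorem datum_XD [Nonempty n] {P : ℕ} (M : ℕ) [NeZero M] (hPM : P = 2 * M) (t : ℝ) :
    dirIter 2 (0 + 1) (1 : Site 4 → Fin 4 → (Matrix n n ℂ)ˣ)
        (fun y ν => XD (n := n) P t y ν - gaugeDir 1 (spikeW (2 ^ (0 + 1)) (framePotW 2 (0 + 1) 1 (XD (n := n) P t))) y ν) = fun _ _ => 0 := by
  have hinner : (fun y ν => XD (n := n) P t y ν - gaugeDir 1 (spikeW (2 ^ (0 + 1)) (framePotW 2 (0 + 1) 1 (XD (n := n) P t))) y ν) = XD (n := n) P t := by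
    rw [spikes_XD ⟨M, hPM⟩]; funext y ν; simp
  rw [hinner]
  exact cpush_XD M hPM t

/-- **THE CORE CONTRADICTION**: for the dipole representative with `t` small against `m₁` and the volume, the `m₁`-line for the corrector
`μ = −λ` is false. [folklore] -/
theorem m1_line_false [Nonempty n] {P : ℕ} (hP2 : 2 ≤ P) (F : Finset (Site 4)) (hF : siteA ∈ F) {m₁ t : ℝ} (ht0 : 0 < t)
    (htm : 8 * |m₁| * ((F.card : ℝ) * 4 * (2 * ‖(Lam0 : Matrix n n ℂ)‖) ^ 2) * t < ‖(Lam0 : Matrix n n ℂ)‖)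
    (h3 : ∑ z ∈ F, ‖-(lamD P t z : Matrix n n ℂ)‖ ≤ m₁ * (((2 : ℕ) : ℝ) ^ (0 + 1)) ^ 3 * energyNormW 2 (0 + 1) (1 : Site 4 → Fin 4 → (Matrix n n ℂ)ˣ) (XD (n := n) P t) F ^ 2) :
    False := by
  set L0 : ℝ := ‖(Lam0 : Matrix n n ℂ)‖ with hL0
  set C0 : ℝ := (F.card : ℝ) * 4 * (2 * L0) ^ 2 with hC0
  have hE := energyNormW_XD_sq_le (n := n) P (0 + 1) ht0.le F
  have hE' : energyNormW 2 (0 + 1) (1 : Site 4 → Fin 4 → (Matrix n n ℂ)ˣ) (XD (n := n) P t) F ^ 2 ≤ t ^ 2 * C0 := by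
    rw [hC0]; nlinarith [hE]
  have hE0 : 0 ≤ energyNormW 2 (0 + 1) (1 : Site 4 → Fin 4 → (Matrix n n ℂ)ˣ) (XD (n := n) P t) F ^ 2 := sq_nonneg _
  have hlow : t * L0 ≤ ∑ z ∈ F, ‖-(lamD P t z : Matrix n n ℂ)‖ := by
    have h1 : ‖-(lamD P t siteA : Matrix n n ℂ)‖ = t * L0 := by rw [norm_neg, norm_lamD_siteA hP2 ht0.le]
    rw [← h1]
    exact Finset.single_le_sum (f := fun z => ‖-(lamD P t z : Matrix n n ℂ)‖) (fun z _ => norm_nonneg _) hF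
  have hup : m₁ * (((2 : ℕ) : ℝ) ^ (0 + 1)) ^ 3 * energyNormW 2 (0 + 1) (1 : Site 4 → Fin 4 → (Matrix n n ℂ)ˣ) (XD (n := n) P t) F ^ 2
      ≤ |m₁| * 8 * (t ^ 2 * C0) := by
    have ha : m₁ * (((2 : ℕ) : ℝ) ^ (0 + 1)) ^ 3 ≤ |m₁| * 8 := by norm_num; exact le_abs_self m₁
    calc m₁ * (((2 : ℕ) : ℝ) ^ (0 + 1)) ^ 3 * energyNormW 2 (0 + 1) (1 : Site 4 → Fin 4 → (Matrix n n ℂ)ˣ) (XD (n := n) P t) F ^ 2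
        ≤ |m₁| * 8 * energyNormW 2 (0 + 1) (1 : Site 4 → Fin 4 → (Matrix n n ℂ)ˣ) (XD (n := n) P t) F ^ 2 := mul_le_mul_of_nonneg_right ha hE0
      _ ≤ |m₁| * 8 * (t ^ 2 * C0) := mul_le_mul_of_nonneg_left hE' (by positivity)
  have hchain : t * L0 ≤ t * (8 * |m₁| * C0 * t) := by nlinarith [hlow, h3, hup]
  have hdiv : L0 ≤ 8 * |m₁| * C0 * t := le_of_mul_le_mul_left hchain ht0
  rw [hC0] at hdiv
  linarith [htm]

end Witness

end

end Summit.QuantumFields.BalabanUV.T4Continuum.NE7DipoleWitnessFrames
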